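import Mathlib
import Literature.Computability.AlgebraicComplexity.EquivariantDC
import Literature.Computability.AlgebraicComplexity.StandardFamilies
import Literature.Computability.AlgebraicComplexity.StandardFamiliesProofs
import Literature.Computability.AlgebraicComplexity.LRPencilOfMatrix
import Literature.Computability.AlgebraicComplexity.LRFullLifts
import Literature.Computability.AlgebraicComplexity.LRLiftCharacter
import Summits.ValiantsHypothesis.ValiantsHypothesis.Theorems.FreeSubtorusOrbitDimensionBoundStubCofactorShape
import HarnessLib

/-!
# Crux `OrbitDimensionBound` (stmt-ValiantsHypothesis-16133), line `affine_multiple`, stub `stub_absorbingSacrifice`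
# — piece (β1): INTEGER WEIGHTS of the linear cofactor are constant on its support

Helper toward the registered stub `stub_absorbingSacrifice` (lead: val-lit-p6 g11; split SPEC
`HOME/lmr/SPEC-p6g11-16133-stub2-split.md`, piece (β1)); `--supports stmt-ValiantsHypothesis-16133 --as helper`;
0 definitions / 0 named facts.

**Statement (`cofactor_intWeights_eq`).**  Let `B` be a `T_Λ`-equivariant (exact lifts) affine determinantal
representation of `per_n · q` with `q` a LINEAR FORM.  Every integer relation `Σ_k x_k Λ_i(inl k) + Σ_l y_l Λ_i(inr l) = 0`
(all `i`) — i.e. the one-parameter subgroup `(2^{x_k}) ⊗ (2^{y_l})` of `T_Λ` — gives all support positions `p` of `q`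
the SAME weight `x_{p.1} + y_{p.2}`.

**Proof** (= steps (1)+(3) of `stub_cofactorShape` with `d = 2^x`, `e = 2^y`): the diagonal element lies in `T_Λ`
(`prod_zpow_eq_zpow_sum_units`, `zpow_mul`); an exact lift gives `(per·q)(γx) = κ (per·q)(x)`
(`IsEquivariantDetRepr.linSubst_eq_smul`), `per(γx) = (∏ d ∏ e) per(x)` (`linSubst_diagonal_perPoly`), cancel `per`
(`perPoly_ne_zero`); on the linear form `q = Σ_v q_v x_v` the substitution multiplies `x_v` by `2^{x_{v.1} + y_{v.2}}`,
so comparing coefficients at two support positions gives `2^{w(p₁)} = 2^{w(p₂)}` in `ℂ`, hence `w(p₁) = w(p₂)`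
(injectivity of `z ↦ 2^z` on `ℝ`).  Consumed by the lead's `FinalMatching` as the uniqueness of the free support.

Honest framing: plumbing inside one stub; `stub_absorbingSacrifice`, the crux and `VP ≠ VNP` remain OPEN.
-/

set_option autoImplicit false
set_option linter.dupNamespace false

noncomputable section

open Matrix MvPolynomial Finset
open scoped Kronecker
open Literature.Computability.AlgebraicComplexity LRPencil

namespace Summit.ValiantsHypothesis.ValiantsHypothesis.Theorems.FreeSubtorusOrbitDimensionBound.AbsorbingSacrifice

/-- Coefficient of `x_p` in a rescaled linear form `Σ_v C (c_v) * X v`. [folklore] -/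
theorem coeff_single_sum_C_mul_X {n : ℕ} (c : Fin n × Fin n → ℂ) (p : Fin n × Fin n) :
    coeff (Finsupp.single p 1) (∑ v, C (c v) * X v : MvPolynomial (Fin n × Fin n) ℂ) = c p := by
  classical
  rw [coeff_sum, Finset.sum_eq_single p]
  · rw [coeff_C_mul, coeff_X, if_pos rfl, mul_one]
  · intro v _ hv
    rw [coeff_C_mul, coeff_X, if_neg, mul_zero]
    intro h
    exact hv (Finsupp.single_left_injective one_ne_zero h)
  · intro h; exact absurd (Finset.mem_univ p) h

/-- **Integer weights of the cofactor are constant on its support** (piece (β1) of the split of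
`stub_absorbingSacrifice`; see the module docstring). [cite: LandsbergRessayre2017, §3, §6] -/
theorem cofactor_intWeights_eq (n m r : ℕ) (Λ : Fin r → (Fin n ⊕ Fin n) → ℤ)
    (B : Matrix (Fin m) (Fin m) (MvPolynomial (Fin n × Fin n) ℂ)) (q : MvPolynomial (Fin n × Fin n) ℂ)
    (hq : q.IsHomogeneous 1)
    (hB : IsEquivariantDetRepr (Subgroup.closure {γ : Matrix.GeneralLinearGroup (Fin n × Fin n) ℂ |
        ∃ d e : Fin n → ℂˣ, (∀ i, (∏ k, (d k) ^ (Λ i (Sum.inl k))) * (∏ l, (e l) ^ (Λ i (Sum.inr l))) = 1) ∧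
          (γ : Matrix (Fin n × Fin n) (Fin n × Fin n) ℂ) = Matrix.diagonal (fun p => (d p.1 : ℂ) * (e p.2 : ℂ))})
      (perPoly (Fin n) ℂ * q) B)
    (x y : Fin n → ℤ) (hxy : ∀ i, (∑ k, x k * Λ i (Sum.inl k)) + (∑ l, y l * Λ i (Sum.inr l)) = 0)
    (p₁ p₂ : Fin n × Fin n) (hp₁ : MvPolynomial.coeff (Finsupp.single p₁ 1) q ≠ 0)
    (hp₂ : MvPolynomial.coeff (Finsupp.single p₂ 1) q ≠ 0) :
    x p₁.1 + y p₁.2 = x p₂.1 + y p₂.2 := by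
  classical
  -- (1) the one-parameter subgroup `(2^x) ⊗ (2^y)` of `T_Λ`
  set u : ℂˣ := Units.mk0 (2 : ℂ) two_ne_zero with hu
  set du : Fin n → ℂˣ := fun k => u ^ (x k) with hdu
  set eu : Fin n → ℂˣ := fun l => u ^ (y l) with heu
  set d : Fin n → ℂ := fun k => ((du k : ℂˣ) : ℂ) with hd
  set e : Fin n → ℂ := fun l => ((eu l : ℂˣ) : ℂ) with he
  have hd0 : ∀ i, d i ≠ 0 := fun i => (du i).ne_zero
  have he0 : ∀ i, e i ≠ 0 := fun i => (eu i).ne_zero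
  let γ : GL (Fin n × Fin n) ℂ := Matrix.GeneralLinearGroup.kronecker (diagUnit ℂ d hd0) (diagUnit ℂ e he0)
  have hγcoe : (γ : Matrix (Fin n × Fin n) (Fin n × Fin n) ℂ) = Matrix.diagonal d ⊗ₖ Matrix.diagonal e :=
    coe_kronecker_diagUnit d e hd0 he0
  have hγmem : γ ∈ Subgroup.closure {γ : Matrix.GeneralLinearGroup (Fin n × Fin n) ℂ |
      ∃ d e : Fin n → ℂˣ, (∀ i, (∏ k, (d k) ^ (Λ i (Sum.inl k))) * (∏ l, (e l) ^ (Λ i (Sum.inr l))) = 1) ∧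
        (γ : Matrix (Fin n × Fin n) (Fin n × Fin n) ℂ) = Matrix.diagonal (fun p => (d p.1 : ℂ) * (e p.2 : ℂ))} := by
    refine Subgroup.subset_closure ⟨du, eu, fun i => ?_, ?_⟩
    · simp only [hdu, heu, ← _root_.zpow_mul]
      rw [prod_zpow_eq_zpow_sum_units, prod_zpow_eq_zpow_sum_units, ← _root_.zpow_add, hxy i, zpow_zero]
    · rw [hγcoe, Matrix.diagonal_kronecker_diagonal]
  -- (2) the linear form
  set a : Fin n × Fin n → ℂ := fun v => coeff (Finsupp.single v 1) q with ha
  have hqL : q = ∑ v, C (a v) * X v := by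
    have h1 := eq_affine_of_totalDegree_le_one q (hq.totalDegree_le)
    have h0 : coeff 0 q = 0 := hq.coeff_eq_zero (by simp)
    rw [h0, C_0, zero_add] at h1
    exact h1
  -- the substitution multiplies `x_v` by `d v.1 * e v.2`
  have hX : ∀ v : Fin n × Fin n,
      linSubst (Fin n × Fin n) ℂ (Matrix.diagonal d ⊗ₖ Matrix.diagonal e) (X v) = C (d v.1 * e v.2) * X v := by
    intro v
    rw [linSubst_X, Matrix.diagonal_kronecker_diagonal, Finset.sum_eq_single v]
    · rw [Matrix.diagonal_apply_eq, MvPolynomial.smul_eq_C_mul]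
    · intro j _ hj; rw [Matrix.diagonal_apply_ne _ hj, zero_smul]
    · intro h; exact absurd (Finset.mem_univ v) h
  have hLq : linSubst (Fin n × Fin n) ℂ (Matrix.diagonal d ⊗ₖ Matrix.diagonal e) q =
      ∑ v, C (a v * (d v.1 * e v.2)) * X v := by
    conv_lhs => rw [hqL]
    rw [map_sum]
    refine Finset.sum_congr rfl fun v _ => ?_
    rw [map_mul, linSubst_C, hX]
    simp only [map_mul]
    ring
  -- (3) the determinant identity of an exact lift, with `per` cancelled
  obtain ⟨g, h, hdet⟩ := hB.linSubst_eq_smul hγmem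
  set κ : ℂ := (g : Matrix (Fin m) (Fin m) ℂ).det * ((h⁻¹ : GL (Fin m) ℂ) : Matrix (Fin m) (Fin m) ℂ).det with hκ
  set P : ℂ := (∏ k, d k) * ∏ j, e j with hP
  have hP0 : P ≠ 0 := mul_ne_zero (Finset.prod_ne_zero_iff.2 fun k _ => hd0 k)
    (Finset.prod_ne_zero_iff.2 fun j _ => he0 j)
  rw [hγcoe, map_mul, linSubst_diagonal_perPoly, hLq] at hdet
  have hcancel : C P * (∑ v, C (a v * (d v.1 * e v.2)) * X v) = C κ * q := by
    have h1 : perPoly (Fin n) ℂ * (C P * ∑ v, C (a v * (d v.1 * e v.2)) * X v) =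
        perPoly (Fin n) ℂ * (C κ * q) := by
      calc perPoly (Fin n) ℂ * (C P * ∑ v, C (a v * (d v.1 * e v.2)) * X v)
          = C P * perPoly (Fin n) ℂ * ∑ v, C (a v * (d v.1 * e v.2)) * X v := by ring
        _ = C κ * (perPoly (Fin n) ℂ * q) := hdet
        _ = perPoly (Fin n) ℂ * (C κ * q) := by ring
    exact mul_left_cancel₀ (perPoly_ne_zero (Fin n) ℂ) h1
  -- compare the coefficients at `p₁`, `p₂`
  have hcoef : ∀ p : Fin n × Fin n, P * (a p * (d p.1 * e p.2)) = κ * a p := by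
    intro p
    have := congrArg (coeff (Finsupp.single p 1)) hcancel
    rw [coeff_C_mul, coeff_single_sum_C_mul_X, coeff_C_mul] at this
    rw [this]
  have hw : ∀ p : Fin n × Fin n, a p ≠ 0 → P * (d p.1 * e p.2) = κ := by
    intro p hp
    have h := hcoef p
    have h' : (P * (d p.1 * e p.2)) * a p = κ * a p := by rw [← h]; ring
    exact mul_right_cancel₀ hp h'
  have h12 : d p₁.1 * e p₁.2 = d p₂.1 * e p₂.2 :=
    mul_left_cancel₀ hP0 ((hw p₁ hp₁).trans (hw p₂ hp₂).symm)
  -- `d k * e l = 2 ^ (x k + y l)`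
  have hde : ∀ p : Fin n × Fin n, d p.1 * e p.2 = (2 : ℂ) ^ (x p.1 + y p.2) := by
    intro p
    simp only [hd, he, hdu, heu, hu, Units.val_zpow_eq_zpow_val, Units.val_mk0]
    rw [_root_.zpow_add₀ (two_ne_zero : (2 : ℂ) ≠ 0)]
  rw [hde, hde] at h12
  -- injectivity of `z ↦ 2^z`
  have h12' : ((2 : ℝ) ^ (x p₁.1 + y p₁.2) : ℝ) = (2 : ℝ) ^ (x p₂.1 + y p₂.2) := by
    have := h12
    rw [show (2 : ℂ) = ((2 : ℝ) : ℂ) by norm_num, ← Complex.ofReal_zpow, ← Complex.ofReal_zpow] at this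
    exact_mod_cast this
  exact zpow_right_injective₀ (by norm_num) (by norm_num) h12'

end Summit.ValiantsHypothesis.ValiantsHypothesis.Theorems.FreeSubtorusOrbitDimensionBound.AbsorbingSacrifice

end
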